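import Literature.NumberTheory.EllipticCurves.ZpExtensionEisensteinDVRSettingH4BadPlacesProofs
import Literature.NumberTheory.EllipticCurves.ZpExtensionEisensteinTwistFilIsotropyProofs
import Literature.NumberTheory.EllipticCurves.TowerSaturatedAnnihilatorProofs
import HarnessLib

/-!
# Howard's H.4 for the curve's Eisenstein setting AT THE PLACES `v ∣ p`: `F_𝔮` (the saturated strict-ordinary condition) is its own
# exact orthogonal complement, given (Exact) in the limit and the module-level isotropy of `Fil_v` (theorems only)

`Proofs` file (theorems only; no definition, no named fact, no instance, no `sorry`).  Topic `NumberTheory/EllipticCurves`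
(D1 road of cell `pub/bsd-print-x9`, LEAD `bsd-line-x10b-p1` g8: (B6-GLUE) = the `v ∣ p` half of the `hfin4` clause / `Stmt.h4AtS`,
companion of `ZpExtensionEisensteinDVRSettingH4BadPlacesProofs` (p667328, the `v ∤ p` half)).

For `T := W.eisensteinTower κ hm`, H.4 data `D` with `he_red`, a conjugation datum `cd`, the Poitou–Tate named fact and a place `v` with
`p ∈ v` (hence `p ∈ σ•v`), `(D k).IsSelfOrthogonalAt F_𝔮 v` follows by w8's GENERAL descent `Tower.levelCondition_mem_iff_forall_pairing_eq_zero`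
(p649469) from: (hB)(hQ)(T) x9-p1-w2 g7 p660339; (Dual) both sides exactly as at the bad places (w4 g5 p659369 with p660780 / p662398 /
p662207 and p665518 / p662903 / p666061); (Iso) = `ZpExtension.localCup_ordinaryCore_eq_zero_of_orthogonal` from the MODULE-LEVEL
hypothesis `hOrth` («`(D j).e` kills `(A ⊗ Fil_v) × δ_v·(A ⊗ Fil_v̄)`», discharged for the Weil–τ data by x10b-p1-w5's isotropy files);
and the two LIMIT inputs **(Exact)** `hExactY` / `hExactX` in the literal binder shapes of p649469 — the (B6-EXACT) deliverables of
x9-p1-w2 g8 / x9-p1-w4 g8 (memo HOME/p1/H4-EXACT-AT-P-PLAN §1).  Identifications: `F_𝔮(v)` = `eisensteinSelmerStructure_inr_of_mem` +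
shift p660339; `Fbar` = (F̄) `eisensteinTowerTriple_cond_map_transportH1_eq_of_mem` (p663435) + twisted shift (p666061).

* **`WeierstrassCurve.eisensteinTower_isSelfOrthogonalAt_of_mem`**.
HONEST FRAMING: conditional on `poitouTate_selmerStructure_duality K`; `hOrth`, `hExactY`, `hExactX` are hypotheses.  No summit
statement is proved; BSD is not proved by any of this.

References: B. Howard, Compositio Math. 140 (2004), §1.3 H.4, Lemma 3.1.1, Def. 3.1.2, Def. 3.2.6 (arXiv:1202.6340 p. 7 L69–82, p. 15–16);
J. S. Milne, *Arithmetic Duality Theorems* (2006), I Cor. 2.3; B. Mazur, K. Rubin, Mem. AMS 799 (2004), §1.3, Lemma 3.7.1.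
-/

set_option autoImplicit false

noncomputable section

open Function NumberField IsDedekindDomain Field CategoryTheory
open scoped NumberField ContRepresentation TensorProduct Classical

namespace WeierstrassCurve

open Literature.NumberTheory.EllipticCurves Literature.NumberTheory.GaloisRepresentations
open Literature.NumberTheory.GaloisRepresentations.DiscreteGaloisModule
open Literature.NumberTheory.GaloisCohomology Literature.NumberTheory.GaloisCohomology.Howard2004
open Literature.NumberTheory.EllipticCurves.ZpExtension (EisensteinLevel)

variable {K : Type} [Field K] [NumberField K] (W : WeierstrassCurve ℚ) [W.IsElliptic] {p : ℕ} [hp : Fact p.Prime]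
  (κ : ZpExtension K p) {m : ℕ} (hm : 1 ≤ m)
  (S : Finset (HeightOneSpectrum (𝓞 K)))
  (hpS : ∀ v : HeightOneSpectrum (𝓞 K), ((p : ℕ) : 𝓞 K) ∈ v.asIdeal → v ∈ S)
  (hbad : ∀ v : HeightOneSpectrum (𝓞 K), v ∉ S → ((p : ℕ) : 𝓞 K) ∉ v.asIdeal → (W.baseChange K).HasGoodReductionAt v)
  (L : Set (HeightOneSpectrum (𝓞 K)))
  (hL : letI := IwasawaAlgebra.isLocalRing_quotient_X_pow_add_C p hm
    L ⊆ (W.eisensteinTower κ hm).degreeTwoPrimes p)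
  (hLS : ∀ v ∈ L, v ∉ S)
  (cd : ConjugationDatum K)
  (D : letI := IwasawaAlgebra.isLocalRing_quotient_X_pow_add_C p hm
    ∀ k, DualityDatum p cd ((W.eisensteinTower κ hm).ρ k) (IwasawaAlgebra.EisensteinCoeff p m (k + 1)))

set_option maxHeartbeats 1600000 in
/-- **H.4 at a place `v ∣ p` for the curve's Eisenstein setting, from (Exact) in the limit.**  With `T := W.eisensteinTower κ hm`, H.4
data `D` satisfying `he_red`, the Poitou–Tate named fact, any conjugation datum, `p ∈ v` and `p ∈ σ•v`, the
module-level isotropy `hOrth` of the twisted plus parts under `(D j).e`, and the two (Exact) limit statements for the saturated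
strict-ordinary families (`hExactY`, `hExactX`, binder shapes of `Tower.levelCondition_mem_iff_forall_pairing_eq_zero`):
`(D k).IsSelfOrthogonalAt F_𝔮 v`. [cite: Howard2004HeegnerKolyvagin, §1.3 H.4, Lemma 3.1.1, Def. 3.1.2, Def. 3.2.6 (arXiv p. 7 L78–82, p. 15–16)]
[cite: MilneADT2006, Ch. I, Cor. 2.3] [cite: MazurRubinMemoirs2004, Lemma 3.7.1] -/
theorem eisensteinTower_isSelfOrthogonalAt_of_mem
    (he_red : letI := IwasawaAlgebra.isLocalRing_quotient_X_pow_add_C p hm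
      ∀ k (x y : EisensteinLevel p m (fun j ↦ geomTorsion (W.baseChange K) ((p : ℤ) ^ j)) (k + 1 + 1)),
        IwasawaAlgebra.EisensteinCoeff.reduce p m (Nat.le_succ (k + 1)) ((D (k + 1)).e x y) =
          (D k).e ((W.eisensteinTower κ hm).red k x) ((W.eisensteinTower κ hm).red k y))
    (hPT : poitouTate_selmerStructure_duality K) (k : ℕ)
    {v : HeightOneSpectrum (𝓞 K)} (hv : ((p : ℕ) : 𝓞 K) ∈ v.asIdeal) (hσv : ((p : ℕ) : 𝓞 K) ∈ (cd.σ • v).asIdeal)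
    (hOrth : letI := IwasawaAlgebra.isLocalRing_quotient_X_pow_add_C p hm
      ∀ j, ∀ s ∈ ((W.baseChange K).ordinaryFiltrationAt v (fun j ↦ (W.baseChange K).torsionGaloisModuleReduce p j) (fun _ _ ↦ rfl)).twistedFil (m := m) (j + 1), ∀ s' ∈ ((W.baseChange K).ordinaryFiltrationAt (cd.σ • v) (fun j ↦ (W.baseChange K).torsionGaloisModuleReduce p j) (fun _ _ ↦ rfl)).twistedFil (m := m) (j + 1),
        (D j).e s ((κ.eisensteinTwist ((W.baseChange K).torsionGaloisModule ((p : ℤ) ^ (j + 1))) hm (j + 1)) (cd.δ v) s') = 0)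
    (hExactY : letI := IwasawaAlgebra.isLocalRing_quotient_X_pow_add_C p hm
      ∀ η ∈ Tower.compatibleFamilies (H := fun j ↦ galoisCohomology ((cd.twist ((W.eisensteinTower κ hm).ρ j)).toLocal (Sum.inr v)) 1) (fun j ↦ ContinuousRep.cohomologyMap ((cd.twist ((W.eisensteinTower κ hm).ρ (j + 1))).toLocal (Sum.inr v))
      ((cd.twist ((W.eisensteinTower κ hm).ρ j)).toLocal (Sum.inr v)) ((W.eisensteinTower κ hm).red j).toAddMonoidHom
      continuous_of_discreteTopology (fun _ z => (W.eisensteinTower κ hm).red_equivariant j _ z) 1),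
        (∀ ξ ∈ Tower.saturatedFamilies (H := fun j ↦ galoisCohomology (((W.eisensteinTower κ hm).ρ j).toLocal (Sum.inr v)) 1) (fun j ↦ ContinuousRep.cohomologyMap (((W.eisensteinTower κ hm).ρ (j + 1)).toLocal (Sum.inr v))
      (((W.eisensteinTower κ hm).ρ j).toLocal (Sum.inr v)) ((W.eisensteinTower κ hm).red j).toAddMonoidHom
      continuous_of_discreteTopology (fun _ z => (W.eisensteinTower κ hm).red_equivariant j _ z) 1) p (fun j ↦ ((W.baseChange K).ordinaryFiltrationAt v (fun j ↦ (W.baseChange K).torsionGaloisModuleReduce p j) (fun _ _ ↦ rfl)).ordinaryCore hm (j + 1)),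
          (D k).localCup (Sum.inr v) (ξ k) (η k) = 0) →
        ∃ η' : Π j, galoisCohomology ((cd.twist ((W.eisensteinTower κ hm).ρ j)).toLocal (Sum.inr v)) 1,
          η - p ^ (k + 1) • η' ∈ Tower.saturatedFamilies (H := fun j ↦ galoisCohomology ((cd.twist ((W.eisensteinTower κ hm).ρ j)).toLocal (Sum.inr v)) 1)
            (fun j ↦ ContinuousRep.cohomologyMap ((cd.twist ((W.eisensteinTower κ hm).ρ (j + 1))).toLocal (Sum.inr v))
      ((cd.twist ((W.eisensteinTower κ hm).ρ j)).toLocal (Sum.inr v)) ((W.eisensteinTower κ hm).red j).toAddMonoidHom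
      continuous_of_discreteTopology (fun _ z => (W.eisensteinTower κ hm).red_equivariant j _ z) 1) p
            (fun j ↦ (((W.baseChange K).ordinaryFiltrationAt (cd.σ • v) (fun j ↦ (W.baseChange K).torsionGaloisModuleReduce p j) (fun _ _ ↦ rfl)).ordinaryCore hm (j + 1)).map
      (cd.transportH1 (κ.eisensteinTwist ((W.baseChange K).torsionGaloisModule ((p : ℤ) ^ (j + 1))) hm (j + 1)) v)))
    (hExactX : letI := IwasawaAlgebra.isLocalRing_quotient_X_pow_add_C p hm
      ∀ ξ ∈ Tower.compatibleFamilies (H := fun j ↦ galoisCohomology (((W.eisensteinTower κ hm).ρ j).toLocal (Sum.inr v)) 1) (fun j ↦ ContinuousRep.cohomologyMap (((W.eisensteinTower κ hm).ρ (j + 1)).toLocal (Sum.inr v))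
      (((W.eisensteinTower κ hm).ρ j).toLocal (Sum.inr v)) ((W.eisensteinTower κ hm).red j).toAddMonoidHom
      continuous_of_discreteTopology (fun _ z => (W.eisensteinTower κ hm).red_equivariant j _ z) 1),
        (∀ η ∈ Tower.saturatedFamilies (H := fun j ↦ galoisCohomology ((cd.twist ((W.eisensteinTower κ hm).ρ j)).toLocal (Sum.inr v)) 1) (fun j ↦ ContinuousRep.cohomologyMap ((cd.twist ((W.eisensteinTower κ hm).ρ (j + 1))).toLocal (Sum.inr v))
      ((cd.twist ((W.eisensteinTower κ hm).ρ j)).toLocal (Sum.inr v)) ((W.eisensteinTower κ hm).red j).toAddMonoidHom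
      continuous_of_discreteTopology (fun _ z => (W.eisensteinTower κ hm).red_equivariant j _ z) 1) p
            (fun j ↦ (((W.baseChange K).ordinaryFiltrationAt (cd.σ • v) (fun j ↦ (W.baseChange K).torsionGaloisModuleReduce p j) (fun _ _ ↦ rfl)).ordinaryCore hm (j + 1)).map
      (cd.transportH1 (κ.eisensteinTwist ((W.baseChange K).torsionGaloisModule ((p : ℤ) ^ (j + 1))) hm (j + 1)) v)),
          (D k).localCup (Sum.inr v) (ξ k) (η k) = 0) →
        ∃ ξ' : Π j, galoisCohomology (((W.eisensteinTower κ hm).ρ j).toLocal (Sum.inr v)) 1,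
          ξ - p ^ (k + 1) • ξ' ∈ Tower.saturatedFamilies (H := fun j ↦ galoisCohomology (((W.eisensteinTower κ hm).ρ j).toLocal (Sum.inr v)) 1)
            (fun j ↦ ContinuousRep.cohomologyMap (((W.eisensteinTower κ hm).ρ (j + 1)).toLocal (Sum.inr v))
      (((W.eisensteinTower κ hm).ρ j).toLocal (Sum.inr v)) ((W.eisensteinTower κ hm).red j).toAddMonoidHom
      continuous_of_discreteTopology (fun _ z => (W.eisensteinTower κ hm).red_equivariant j _ z) 1) p (fun j ↦ ((W.baseChange K).ordinaryFiltrationAt v (fun j ↦ (W.baseChange K).torsionGaloisModuleReduce p j) (fun _ _ ↦ rfl)).ordinaryCore hm (j + 1))) :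
    letI := IwasawaAlgebra.isLocalRing_quotient_X_pow_add_C p hm
    (D k).IsSelfOrthogonalAt (W.eisensteinTowerTriple κ hm S hpS hbad L hL hLS k).cond v := by
  letI := IwasawaAlgebra.isLocalRing_quotient_X_pow_add_C p hm
  have hpp := hp.out
  have hpK : (p : K) ≠ 0 := by exact_mod_cast hpp.ne_zero
  -- finiteness of the levels and of the local `H¹`'s
  haveI hfinM : ∀ j, Finite (EisensteinLevel p m (fun j ↦ geomTorsion (W.baseChange K) ((p : ℤ) ^ j)) (j + 1)) := fun j ↦ by
    haveI : Finite (geomTorsion (W.baseChange K) ((p : ℤ) ^ (j + 1))) :=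
      finite_torsionPoints_holds (W.baseChange K) (AlgebraicClosure K) (n := (p : ℤ) ^ (j + 1))
        (pow_ne_zero _ (by exact_mod_cast hpp.ne_zero))
    exact IwasawaAlgebra.EisensteinCoeff.finite_twisted (p := p) (k := j + 1)
      (M := geomTorsion (W.baseChange K) ((p : ℤ) ^ (j + 1))) hm
  haveI : ∀ j, Finite (galoisCohomology ((cd.twist ((W.eisensteinTower κ hm).ρ j)).toLocal (Sum.inr v)) 1) := fun j ↦
    finite_galoisCohomology_one_toLocal _ v
  haveI : ∀ j, Finite (galoisCohomology (((W.eisensteinTower κ hm).ρ j).toLocal (Sum.inr v)) 1) := fun j ↦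
    finite_galoisCohomology_one_toLocal _ v
  -- (hB), (hQ), (T)
  obtain ⟨hB, hQ, hTX, hTY⟩ := W.eisensteinTower_localCup_towerCompat κ hm cd D he_red hPT v k
  -- (Dual), `Y`-side
  obtain ⟨incQ, hAdj⟩ := W.eisensteinTower_exists_incQ_localCup_towerAdjoint κ hm cd D he_red (Sum.inr v) k
  obtain ⟨hPerf, hNondeg⟩ := W.eisensteinTower_localCup_towerDuality κ hm cd D hPT v k
  have hDualY := Tower.mem_levelCondition_top_of_forall_pairing_bot_eq_zero_of_range
    (X := fun j ↦ galoisCohomology (((W.eisensteinTower κ hm).ρ j).toLocal (Sum.inr v)) 1)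
    (Y := fun j ↦ galoisCohomology ((cd.twist ((W.eisensteinTower κ hm).ρ j)).toLocal (Sum.inr v)) 1)
    (Q := fun j ↦ galoisCohomology ((D j).twistOne.toLocal (Sum.inr v)) 2)
    (fun j ↦ ContinuousRep.cohomologyMap (((W.eisensteinTower κ hm).ρ (j + 1)).toLocal (Sum.inr v))
      (((W.eisensteinTower κ hm).ρ j).toLocal (Sum.inr v)) ((W.eisensteinTower κ hm).red j).toAddMonoidHom
      continuous_of_discreteTopology (fun _ z => (W.eisensteinTower κ hm).red_equivariant j _ z) 1)
    (fun j ↦ ContinuousRep.cohomologyMap ((cd.twist ((W.eisensteinTower κ hm).ρ (j + 1))).toLocal (Sum.inr v))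
      ((cd.twist ((W.eisensteinTower κ hm).ρ j)).toLocal (Sum.inr v)) ((W.eisensteinTower κ hm).red j).toAddMonoidHom
      continuous_of_discreteTopology (fun _ z => (W.eisensteinTower κ hm).red_equivariant j _ z) 1)
    (fun j ↦ (D j).localCup (Sum.inr v)) p k
    (fun d ↦ galoisCohomology.map (Literature.NumberTheory.EllipticCurves.DiscreteGaloisModule.localMap
      ((W.baseChange K).eisensteinTwistTorsionTransfer κ hm (fun j ↦ (W.baseChange K).torsionGaloisModuleReduce p j)
        (W.torsionGaloisModuleReduce_coe (K := K) (p := p)) (k + 1) (k + d + 1)) (Sum.inr v)) 1)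
    incQ hPerf hAdj hNondeg
    (fun d x hx ↦ W.eisensteinTower_ker_map_transfer_le_levelCondition_bot' κ hm v k d ((AddMonoidHom.mem_ker).2 hx))
  -- (Dual), `X`-side (flipped pairing)
  obtain ⟨incQ', hAdj'⟩ := W.eisensteinTower_exists_incQ_localCup_towerAdjoint_left κ hm cd D he_red (Sum.inr v) k
  obtain ⟨hPerfL, -⟩ := W.eisensteinTower_localCup_towerDuality_left κ hm cd D hPT v k
  have hNondeg' : ∀ (d : ℕ) (y : galoisCohomology ((cd.twist ((W.eisensteinTower κ hm).ρ (k + d))).toLocal (Sum.inr v)) 1),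
      (∀ x : galoisCohomology (((W.eisensteinTower κ hm).ρ (k + d)).toLocal (Sum.inr v)) 1,
        ((D (k + d)).localCup (Sum.inr v)).flip y x = 0) → y = 0 :=
    fun d y hy ↦ (W.eisensteinTower_localCup_nondegenerate κ hm cd D hPT (k + d) v).2 y fun x ↦ hy x
  have hPerfL' : ∀ (d : ℕ) (x : galoisCohomology (((W.eisensteinTower κ hm).ρ k).toLocal (Sum.inr v)) 1),
      (∀ y : galoisCohomology ((cd.twist ((W.eisensteinTower κ hm).ρ k)).toLocal (Sum.inr v)) 1,
        (∀ t ∈ (Tower.redIter (H := fun j ↦ galoisCohomology (((W.eisensteinTower κ hm).ρ j).toLocal (Sum.inr v)) 1)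
            (fun j ↦ ContinuousRep.cohomologyMap (((W.eisensteinTower κ hm).ρ (j + 1)).toLocal (Sum.inr v))
      (((W.eisensteinTower κ hm).ρ j).toLocal (Sum.inr v)) ((W.eisensteinTower κ hm).red j).toAddMonoidHom
      continuous_of_discreteTopology (fun _ z => (W.eisensteinTower κ hm).red_equivariant j _ z) 1) k d).range,
          ((D k).localCup (Sum.inr v)).flip y t = 0) → ((D k).localCup (Sum.inr v)).flip y x = 0) →
      x ∈ (Tower.redIter (H := fun j ↦ galoisCohomology (((W.eisensteinTower κ hm).ρ j).toLocal (Sum.inr v)) 1)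
        (fun j ↦ ContinuousRep.cohomologyMap (((W.eisensteinTower κ hm).ρ (j + 1)).toLocal (Sum.inr v))
      (((W.eisensteinTower κ hm).ρ j).toLocal (Sum.inr v)) ((W.eisensteinTower κ hm).red j).toAddMonoidHom
      continuous_of_discreteTopology (fun _ z => (W.eisensteinTower κ hm).red_equivariant j _ z) 1) k d).range :=
    fun d x hx ↦ hPerfL d x fun y hy ↦ hx y fun t ht ↦ hy t ht
  have hAdj'' : ∀ (d : ℕ) (y : galoisCohomology ((cd.twist ((W.eisensteinTower κ hm).ρ k)).toLocal (Sum.inr v)) 1)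
      (w : galoisCohomology (((W.eisensteinTower κ hm).ρ (k + d)).toLocal (Sum.inr v)) 1),
      incQ' d (((D k).localCup (Sum.inr v)).flip y
        (Tower.redIter (H := fun j ↦ galoisCohomology (((W.eisensteinTower κ hm).ρ j).toLocal (Sum.inr v)) 1)
          (fun j ↦ ContinuousRep.cohomologyMap (((W.eisensteinTower κ hm).ρ (j + 1)).toLocal (Sum.inr v))
      (((W.eisensteinTower κ hm).ρ j).toLocal (Sum.inr v)) ((W.eisensteinTower κ hm).red j).toAddMonoidHom
      continuous_of_discreteTopology (fun _ z => (W.eisensteinTower κ hm).red_equivariant j _ z) 1) k d w)) =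
        ((D (k + d)).localCup (Sum.inr v)).flip
          (galoisCohomology.map (Literature.NumberTheory.EllipticCurves.DiscreteGaloisModule.localMap
      (Literature.NumberTheory.EllipticCurves.DiscreteGaloisModule.restrictMap
        ((W.baseChange K).eisensteinTwistTorsionTransfer κ hm (fun j ↦ (W.baseChange K).torsionGaloisModuleReduce p j)
          (W.torsionGaloisModuleReduce_coe (K := K) (p := p)) (k + 1) (k + d + 1)) cd.conj) (Sum.inr v)) 1 y) w :=
    fun d y w ↦ hAdj' d y w
  have hDualX := Tower.mem_levelCondition_top_of_forall_pairing_bot_eq_zero_of_range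
    (X := fun j ↦ galoisCohomology ((cd.twist ((W.eisensteinTower κ hm).ρ j)).toLocal (Sum.inr v)) 1)
    (Y := fun j ↦ galoisCohomology (((W.eisensteinTower κ hm).ρ j).toLocal (Sum.inr v)) 1)
    (Q := fun j ↦ galoisCohomology ((D j).twistOne.toLocal (Sum.inr v)) 2)
    (fun j ↦ ContinuousRep.cohomologyMap ((cd.twist ((W.eisensteinTower κ hm).ρ (j + 1))).toLocal (Sum.inr v))
      ((cd.twist ((W.eisensteinTower κ hm).ρ j)).toLocal (Sum.inr v)) ((W.eisensteinTower κ hm).red j).toAddMonoidHom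
      continuous_of_discreteTopology (fun _ z => (W.eisensteinTower κ hm).red_equivariant j _ z) 1)
    (fun j ↦ ContinuousRep.cohomologyMap (((W.eisensteinTower κ hm).ρ (j + 1)).toLocal (Sum.inr v))
      (((W.eisensteinTower κ hm).ρ j).toLocal (Sum.inr v)) ((W.eisensteinTower κ hm).red j).toAddMonoidHom
      continuous_of_discreteTopology (fun _ z => (W.eisensteinTower κ hm).red_equivariant j _ z) 1)
    (fun j ↦ ((D j).localCup (Sum.inr v)).flip) p k
    (fun d ↦ galoisCohomology.map (Literature.NumberTheory.EllipticCurves.DiscreteGaloisModule.localMap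
      (Literature.NumberTheory.EllipticCurves.DiscreteGaloisModule.restrictMap
        ((W.baseChange K).eisensteinTwistTorsionTransfer κ hm (fun j ↦ (W.baseChange K).torsionGaloisModuleReduce p j)
          (W.torsionGaloisModuleReduce_coe (K := K) (p := p)) (k + 1) (k + d + 1)) cd.conj) (Sum.inr v)) 1)
    incQ' hPerfL' hAdj'' hNondeg'
    (fun d y hy ↦ W.eisensteinTower_ker_map_twist_transfer_le_levelCondition_bot κ hm cd v k d ((AddMonoidHom.mem_ker).2 hy))
  -- (Iso): the strict ordinary cores at `v` and the transported ones from `σ•v`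
  have hC : ∀ j, ∀ x ∈ (fun j ↦ ((W.baseChange K).ordinaryFiltrationAt v (fun j ↦ (W.baseChange K).torsionGaloisModuleReduce p j) (fun _ _ ↦ rfl)).ordinaryCore hm (j + 1)) j, ∀ y ∈ (fun j ↦ (((W.baseChange K).ordinaryFiltrationAt (cd.σ • v) (fun j ↦ (W.baseChange K).torsionGaloisModuleReduce p j) (fun _ _ ↦ rfl)).ordinaryCore hm (j + 1)).map
      (cd.transportH1 (κ.eisensteinTwist ((W.baseChange K).torsionGaloisModule ((p : ℤ) ^ (j + 1))) hm (j + 1)) v)) j, (D j).localCup (Sum.inr v) x y = 0 := by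
    intro j x hx y hy
    exact ZpExtension.localCup_ordinaryCore_eq_zero_of_orthogonal hm (j + 1) cd κ
      (fun j ↦ (W.baseChange K).torsionGaloisModule ((p : ℤ) ^ j)) (fun j ↦ (W.baseChange K).torsionGaloisModuleReduce p j) v
      ((W.baseChange K).ordinaryFiltrationAt v (fun j ↦ (W.baseChange K).torsionGaloisModuleReduce p j) (fun _ _ ↦ rfl)) ((W.baseChange K).ordinaryFiltrationAt (cd.σ • v) (fun j ↦ (W.baseChange K).torsionGaloisModuleReduce p j) (fun _ _ ↦ rfl)) (D j) (hOrth j) hx hy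
  -- the general descent
  have hdesc := Tower.levelCondition_mem_iff_forall_pairing_eq_zero
    (X := fun j ↦ galoisCohomology (((W.eisensteinTower κ hm).ρ j).toLocal (Sum.inr v)) 1)
    (Y := fun j ↦ galoisCohomology ((cd.twist ((W.eisensteinTower κ hm).ρ j)).toLocal (Sum.inr v)) 1)
    (Q := fun j ↦ galoisCohomology ((D j).twistOne.toLocal (Sum.inr v)) 2)
    (fun j ↦ ContinuousRep.cohomologyMap (((W.eisensteinTower κ hm).ρ (j + 1)).toLocal (Sum.inr v))
      (((W.eisensteinTower κ hm).ρ j).toLocal (Sum.inr v)) ((W.eisensteinTower κ hm).red j).toAddMonoidHom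
      continuous_of_discreteTopology (fun _ z => (W.eisensteinTower κ hm).red_equivariant j _ z) 1)
    (fun j ↦ ContinuousRep.cohomologyMap ((cd.twist ((W.eisensteinTower κ hm).ρ (j + 1))).toLocal (Sum.inr v))
      ((cd.twist ((W.eisensteinTower κ hm).ρ j)).toLocal (Sum.inr v)) ((W.eisensteinTower κ hm).red j).toAddMonoidHom
      continuous_of_discreteTopology (fun _ z => (W.eisensteinTower κ hm).red_equivariant j _ z) 1)
    (fun j ↦ ContinuousRep.cohomologyMap ((D (j + 1)).twistOne.toLocal (Sum.inr v)) ((D j).twistOne.toLocal (Sum.inr v))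
      (IwasawaAlgebra.EisensteinCoeff.reduce p m (Nat.le_succ (j + 1))).toAddMonoidHom
      continuous_of_discreteTopology (fun _ z => W.reduce_twistOne κ hm cd D j _ z) 2)
    (fun j ↦ (D j).localCup (Sum.inr v)) p
    (fun j ↦ ((W.baseChange K).ordinaryFiltrationAt v (fun j ↦ (W.baseChange K).torsionGaloisModuleReduce p j) (fun _ _ ↦ rfl)).ordinaryCore hm (j + 1))
    (fun j ↦ (((W.baseChange K).ordinaryFiltrationAt (cd.σ • v) (fun j ↦ (W.baseChange K).torsionGaloisModuleReduce p j) (fun _ _ ↦ rfl)).ordinaryCore hm (j + 1)).map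
      (cd.transportH1 (κ.eisensteinTwist ((W.baseChange K).torsionGaloisModule ((p : ℤ) ^ (j + 1))) hm (j + 1)) v))
    hB hQ hC k (p ^ (k + 1)) hTX hTY hDualY (fun x hx ↦ hDualX x fun y hy ↦ hx y hy) hExactY hExactX
  -- `F_𝔮(v)` and `Fbar` are the two level conditions
  have h𝓕 : (W.eisensteinTowerTriple κ hm S hpS hbad L hL hLS k).cond (Sum.inr v) =
      Tower.levelCondition (H := fun j ↦ galoisCohomology (((W.eisensteinTower κ hm).ρ j).toLocal (Sum.inr v)) 1)
        (fun j ↦ ContinuousRep.cohomologyMap (((W.eisensteinTower κ hm).ρ (j + 1)).toLocal (Sum.inr v))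
      (((W.eisensteinTower κ hm).ρ j).toLocal (Sum.inr v)) ((W.eisensteinTower κ hm).red j).toAddMonoidHom
      continuous_of_discreteTopology (fun _ z => (W.eisensteinTower κ hm).red_equivariant j _ z) 1) p
        (fun j ↦ ((W.baseChange K).ordinaryFiltrationAt v (fun j ↦ (W.baseChange K).torsionGaloisModuleReduce p j) (fun _ _ ↦ rfl)).ordinaryCore hm (j + 1)) k := by
    unfold eisensteinTowerTriple
    rw [eisensteinSelmerTriple_cond, κ.eisensteinSelmerStructure_inr_of_mem _ _ hm S _ (k + 1) hv]
    exact W.levelCondition_eisensteinLocalReduce_succ κ hm (Sum.inr v) _ k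
  have hFbar : ((W.eisensteinTowerTriple κ hm S hpS hbad L hL hLS k).cond (Sum.inr (cd.σ • v))).map
        (cd.transportH1 ((W.eisensteinTower κ hm).ρ k) v) =
      Tower.levelCondition (H := fun j ↦ galoisCohomology ((cd.twist ((W.eisensteinTower κ hm).ρ j)).toLocal (Sum.inr v)) 1)
        (fun j ↦ ContinuousRep.cohomologyMap ((cd.twist ((W.eisensteinTower κ hm).ρ (j + 1))).toLocal (Sum.inr v))
      ((cd.twist ((W.eisensteinTower κ hm).ρ j)).toLocal (Sum.inr v)) ((W.eisensteinTower κ hm).red j).toAddMonoidHom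
      continuous_of_discreteTopology (fun _ z => (W.eisensteinTower κ hm).red_equivariant j _ z) 1) p
        (fun j ↦ (((W.baseChange K).ordinaryFiltrationAt (cd.σ • v) (fun j ↦ (W.baseChange K).torsionGaloisModuleReduce p j) (fun _ _ ↦ rfl)).ordinaryCore hm (j + 1)).map
      (cd.transportH1 (κ.eisensteinTwist ((W.baseChange K).torsionGaloisModule ((p : ℤ) ^ (j + 1))) hm (j + 1)) v)) k := by
    rw [W.eisensteinTowerTriple_cond_map_transportH1_eq_of_mem κ hm S hpS hbad L hL hLS cd k v hσv]
    haveI := W.subsingleton_galoisCohomology_twist_eisensteinLevel_zero κ hm cd (Sum.inr v)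
    rw [Tower.levelCondition_succ_eq_levelCondition_shift _ p _ k]
    rfl
  -- conclude
  unfold DualityDatum.IsSelfOrthogonalAt
  simp only []
  rw [hFbar, h𝓕]
  exact hdesc

end WeierstrassCurve

end
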